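import Summits.ResolutionOfSingularities.ResolutionOfSingularities.Theorems.FrobeniusLadderFInjectiveMacaulayficationFDStorey1CellTables
import Summits.ResolutionOfSingularities.ResolutionOfSingularities.Theorems.FrobeniusLadderFInjectiveMacaulayficationQuotientOriginMaximal
import Summits.ResolutionOfSingularities.ResolutionOfSingularities.Theorems.FrobeniusLadderFInjectiveMacaulayficationFermatCubicConeChar2
import Summits.ResolutionOfSingularities.ResolutionOfSingularities.Theorems.FrobeniusLadderFInjectiveMacaulayficationPConeFedderData
import Mathlib.RingTheory.Jacobson.Ring
import HarnessLib

/-!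
# BED D STOREY 1 — THE EXCEPTIONAL POINT IDEAL `𝔪_P = (Y₀, Y₁, Y₂ + 1, Y₃, Y₄)` OF THE TWO P-CHARTS: maximality (via the characteristic-2 involution `Y₂ ↦ Y₂ + 1`),
# membership of the strict transforms `g₂₆₆, g₂₇₇`, `Y₂ ∉ 𝔪_P`, and a Jacobson lemma (a prime other than a maximal `m` lies under a maximal ideal other than `m`)
# (crux `FInjectiveMacaulayfication` stmt-ResolutionOfSingularities-15315, chain w45a; (W-TD) BED D storey 1 (D-1), res-L1-w45a-plan-1 R21.18 (4); seat res-L1-w45a-stub-2 g10)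

Support file for crux stmt-ResolutionOfSingularities-15315 (`FrobeniusLadder.FInjectiveMacaulayfication`), chain w45a.
[OURS · L1 W4.5a] — NOT a statement of any manuscript; AI-written, weaker than expert review.

The avoid generators `HS` of `FDStorey1CellTables` evaluate to `Y₀, Y₁, Y₂ + 1, Y₃, Y₄` (`HS_map_evalL`); their span `𝔪_P` is the image of the origin ideal under the involution
`τ : Y₂ ↦ Y₂ + 1` (`tau_involutive`, char 2), hence MAXIMAL (`isMaximal_span_HS`); `g ∈ 𝔪_P ↔ constantCoeff (τ g) = 0` (`mem_span_HS_iff`), so the strict transforms of the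
P-charts 266, 277 (read off the table, `G_P`) lie in `𝔪_P` (`evalL_G_mem_span_HS`: `P = (0,0,1,0,0)` IS a point of both charts) and `Y₂ ∉ 𝔪_P`. §2 `exists_isMaximal_ne` (any Jacobson
ring). Consumer: `FDStorey1BlowupFull` (FULL off `P`). No definitions, no named facts. [folklore]
-/

-- single-problem summit: the doubled namespace component is forced
set_option linter.dupNamespace false

noncomputable section

namespace Summit.ResolutionOfSingularities.ResolutionOfSingularities.Theorems.FInjectiveMacaulayfication.FDStorey1PIdeal

open MvPolynomial
open Summit.ResolutionOfSingularities.ResolutionOfSingularities.Theorems.FInjectiveMacaulayfication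
open FDStorey1Fan

variable (k : Type) [Field k]

/-! ## §1 The translation involution `τ : Y₂ ↦ Y₂ + 1` (characteristic 2) and the point ideal `𝔪_P = (Y₀, Y₁, Y₂ + 1, Y₃, Y₄)` -/

/-- In characteristic 2 the substitution `Y₂ ↦ Y₂ + 1` is an involution of `k[Y₀,…,Y₄]`. [folklore] -/
theorem tau_involutive [CharP k 2] :
    Function.Involutive (aeval (fun i : Fin 5 => if i = 2 then (X 2 + 1 : MvPolynomial (Fin 5) k) else X i) :
      MvPolynomial (Fin 5) k → MvPolynomial (Fin 5) k) := by
  have h2 : (2 : MvPolynomial (Fin 5) k) = 0 := (FermatCubicConeChar2.two_three k (n := 5)).1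
  set τ := aeval (R := k) (fun i : Fin 5 => if i = 2 then (X 2 + 1 : MvPolynomial (Fin 5) k) else X i) with hτ
  have hcomp : τ.comp τ = AlgHom.id k _ := by
    refine MvPolynomial.algHom_ext fun i => ?_
    rw [AlgHom.comp_apply, AlgHom.id_apply, hτ, aeval_X]
    by_cases hi : i = 2
    · subst hi
      rw [if_pos rfl, map_add, map_one, aeval_X, if_pos rfl, add_assoc, show (1 : MvPolynomial (Fin 5) k) + 1 = 2 by norm_num, h2, add_zero]
    · rw [if_neg hi, aeval_X, if_neg hi]
  intro p
  have := congrArg (fun φ : MvPolynomial (Fin 5) k →ₐ[k] MvPolynomial (Fin 5) k => φ p) hcomp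
  simpa using this

/-- The avoid generators of the P-charts evaluate to `Y₀, Y₁, Y₂ + 1, Y₃, Y₄`. [generated-table reading] -/
theorem HS_map_evalL : HS.map (KLocCellKit.evalL k) = [X 0, X 1, X 2 + 1, X 3, X 4] := by
  simp only [HS, List.map_cons, List.map_nil, KLocCellKit.evalL, List.sum_cons, List.sum_nil, Int.cast_one, PConeFedderData.monomial_five]
  norm_num [add_comm]

/-- `𝔪_P := span {Y₀, Y₁, Y₂ + 1, Y₃, Y₄}` is the image of the origin ideal `(Y₀,…,Y₄)` under `τ`. [folklore] -/
theorem span_HS_eq_map_tau [CharP k 2] :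
    Ideal.span {x | x ∈ HS.map (KLocCellKit.evalL k)} =
      (idealOfVars (Fin 5) k).map (aeval (fun i : Fin 5 => if i = 2 then (X 2 + 1 : MvPolynomial (Fin 5) k) else X i)).toRingHom := by
  rw [HS_map_evalL, idealOfVars, Ideal.map_span, ← Set.range_comp]
  congr 1
  ext x
  simp only [List.mem_cons, List.not_mem_nil, or_false, Set.mem_setOf_eq, Set.mem_range, Function.comp_apply, AlgHom.toRingHom_eq_coe,
    RingHom.coe_coe, aeval_X]
  constructor
  · rintro (rfl | rfl | rfl | rfl | rfl)
    · exact ⟨0, by simp⟩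
    · exact ⟨1, by simp⟩
    · exact ⟨2, by simp⟩
    · exact ⟨3, by simp⟩
    · exact ⟨4, by simp⟩
  · rintro ⟨i, rfl⟩
    fin_cases i <;> simp

/-- ★ `𝔪_P = (Y₀, Y₁, Y₂ + 1, Y₃, Y₄)` is a maximal ideal of `k[Y]` (the image of the maximal origin ideal under the automorphism `τ`). [folklore] -/
theorem isMaximal_span_HS [CharP k 2] : (Ideal.span {x | x ∈ HS.map (KLocCellKit.evalL k)}).IsMaximal := by
  rw [span_HS_eq_map_tau]
  exact (Ideal.isMaximal_map_iff_of_bijective _ (tau_involutive k).bijective).mpr (QuotientOriginMaximal.idealOfVars_isMaximal k)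

/-- Membership in `𝔪_P` is vanishing of the constant coefficient after the substitution `Y₂ ↦ Y₂ + 1`. [folklore] -/
theorem mem_span_HS_iff [CharP k 2] (g : MvPolynomial (Fin 5) k) :
    g ∈ Ideal.span {x | x ∈ HS.map (KLocCellKit.evalL k)} ↔
      constantCoeff (aeval (fun i : Fin 5 => if i = 2 then (X 2 + 1 : MvPolynomial (Fin 5) k) else X i) g) = 0 := by
  rw [span_HS_eq_map_tau, ← QuotientOriginMaximal.mem_idealOfVars_iff]
  set τ := aeval (R := k) (fun i : Fin 5 => if i = 2 then (X 2 + 1 : MvPolynomial (Fin 5) k) else X i) with hτ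
  constructor
  · intro hg
    have h := Ideal.mem_map_of_mem τ.toRingHom hg
    rw [Ideal.map_map] at h
    have hid : τ.toRingHom.comp τ.toRingHom = RingHom.id _ := RingHom.ext fun p => (tau_involutive k) p
    rw [hid, Ideal.map_id] at h
    exact h
  · intro hg
    have h := Ideal.mem_map_of_mem τ.toRingHom hg
    have : τ.toRingHom (τ g) = g := (tau_involutive k) g
    rw [this] at h
    exact h

/-- `Y₂ ∉ 𝔪_P`. [folklore] -/
theorem X2_not_mem_span_HS [CharP k 2] : (X 2 : MvPolynomial (Fin 5) k) ∉ Ideal.span {x | x ∈ HS.map (KLocCellKit.evalL k)} := by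
  rw [mem_span_HS_iff, aeval_X, if_pos rfl]
  simp

/-- The strict transforms of the two P-charts, read off the table. [generated-table reading] -/
theorem G_P : G ⟨266, by decide⟩ = [((1 : ℤ), ![0, 0, 0, 0, 0]), ((1 : ℤ), ![0, 0, 2, 1, 4]), ((1 : ℤ), ![0, 0, 2, 0, 0]), ((1 : ℤ), ![0, 3, 2, 0, 0]),
      ((1 : ℤ), ![3, 0, 2, 0, 0]), ((1 : ℤ), ![0, 0, 3, 2, 1])] ∧
    G ⟨277, by decide⟩ = [((1 : ℤ), ![0, 0, 2, 0, 0]), ((1 : ℤ), ![0, 0, 1, 1, 4]), ((1 : ℤ), ![0, 0, 0, 0, 0]), ((1 : ℤ), ![0, 3, 0, 0, 0]),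
      ((1 : ℤ), ![3, 0, 0, 0, 0]), ((1 : ℤ), ![0, 0, 1, 2, 1])] := by
  decide +kernel

/-- ★ The strict transforms `g₂₆₆`, `g₂₇₇` vanish at `P`: `g_c ∈ 𝔪_P`. [certificate reading] -/
theorem evalL_G_mem_span_HS [CharP k 2] (c : Fin 327) (hc : c.val = 266 ∨ c.val = 277) :
    KLocCellKit.evalL k (G c) ∈ Ideal.span {x | x ∈ HS.map (KLocCellKit.evalL k)} := by
  have h2 : (2 : k) = 0 := by
    have := CharP.cast_eq_zero k 2
    norm_cast at this
  rw [mem_span_HS_iff]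
  rcases hc with hc | hc
  · have : c = ⟨266, by decide⟩ := Fin.ext hc
    subst this
    rw [G_P.1]
    simp [KLocCellKit.evalL, PConeFedderData.monomial_five, constantCoeff_X]
    rw [show (1 : k) + 1 = 2 by norm_num, h2]
  · have : c = ⟨277, by decide⟩ := Fin.ext hc
    subst this
    rw [G_P.2]
    simp [KLocCellKit.evalL, PConeFedderData.monomial_five, constantCoeff_X]
    rw [show (1 : k) + 1 = 2 by norm_num, h2]

/-! ## §2 Jacobson: a prime other than a given maximal ideal lies under another maximal ideal -/

/-- In a Jacobson ring, a prime ideal different from a maximal ideal `m` is contained in a maximal ideal different from `m`. [folklore] -/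
theorem exists_isMaximal_ne {B : Type} [CommRing B] [IsJacobsonRing B] (q : Ideal B) [hq : q.IsPrime] (m : Ideal B) (hqm : q ≠ m) :
    ∃ Q : Ideal B, Q.IsMaximal ∧ q ≤ Q ∧ Q ≠ m := by
  by_contra! H
  have hjac : q.jacobson = q := IsJacobsonRing.out ‹_› hq.isRadical
  obtain ⟨Q₀, hQ₀, hqQ₀⟩ := Ideal.exists_le_maximal q hq.ne_top
  have hQ₀m : Q₀ = m := H Q₀ hQ₀ hqQ₀
  have hset : {J : Ideal B | q ≤ J ∧ J.IsMaximal} = {m} := by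
    ext J
    simp only [Set.mem_setOf_eq, Set.mem_singleton_iff]
    exact ⟨fun h => H J h.2 h.1, fun h => h ▸ ⟨hQ₀m ▸ hqQ₀, hQ₀m ▸ hQ₀⟩⟩
  apply hqm
  rw [← hjac, Ideal.jacobson, hset, sInf_singleton]

end Summit.ResolutionOfSingularities.ResolutionOfSingularities.Theorems.FInjectiveMacaulayfication.FDStorey1PIdeal

end
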